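import Mathlib.Analysis.InnerProductSpace.LinearPMap
import Mathlib.Analysis.InnerProductSpace.Positive
import Mathlib.Analysis.InnerProductSpace.Rayleigh
import Mathlib.Topology.Algebra.Module.LinearPMap
import Mathlib.LinearAlgebra.Eigenspace.Basic
import HarnessLib

-- provenance: harness21/H21/H21/Prelude/UnbddOp/SymmetricPMap.lean @ ec52c55 (interim HEAD d8f2665); M5 mechanical rewrite
/-!
# Symmetric partially defined operators and their quadratic forms

Trunk: UnbddOp (prelude item C1 `SymmetricPMap`; notions `spectral_gap_unbounded`,
`hilbert_polya_operator`, `linearized_boltzmann_spectral`).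

For a partially defined linear operator `A : E →ₗ.[𝕜] E` on an inner product space `E` over
`𝕜 = ℝ` or `ℂ` we set up the quadratic-form vocabulary used by the spectral-gap, Hilbert–Pólya
and linearised-Boltzmann statements:

* `LinearPMap.IsSymmetric A`: `⟪A x, y⟫ = ⟪x, A y⟫` on `dom A` (Reed–Simon I, §VIII.2,
  Definition p. 255), i.e. `A` is a formal adjoint of itself;
* `LinearPMap.IsPositive A`: symmetric and `0 ≤ re ⟪x, A x⟫` (Reed–Simon II, §X.3; Kato,
  *Perturbation Theory*, V §3.10);
* `LinearPMap.rayleighQuotient A x = re ⟪x, A x⟫ / ‖x‖²` (Reed–Simon IV, §XIII.1);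
* `LinearPMap.IsBoundedBelowOn A K c`: `A ≥ c` on `dom A ∩ K` (Kato V §3.10, "bounded from below");
* `LinearPMap.infRayleighOn A K`: the bottom of the (form) spectrum on `K` (min–max, Reed–Simon IV,
  Theorem XIII.1);
* `LinearPMap.eigenspace`, `HasEigenvalue`, `HasEigenvector`, `kernel`: eigen-vocabulary for
  partially defined operators (mirroring `Module.End.eigenspace`, `Module.End.HasEigenvalue`);
* `LinearPMap.IsEssentiallySelfAdjoint A`: `A` is closable and its closure is self-adjoint
  (Reed–Simon I, §VIII.2, Definition p. 256).

## Mathlib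

Mathlib already provides, and we use without redefinition: `LinearPMap`,
`LinearPMap.IsFormalAdjoint`, `LinearPMap.adjoint` (`A†`), `LinearPMap.instStar` (so that
`IsSelfAdjoint A` makes sense for `A : E →ₗ.[𝕜] E` when `E` is complete),
`LinearPMap.isSelfAdjoint_def`, `IsSelfAdjoint.dense_domain`, `LinearPMap.closure`,
`LinearPMap.IsClosable`, `LinearPMap.HasCore`, `LinearMap.toPMap`, `LinearMap.IsSymmetric`,
`LinearMap.IsPositive`, `ContinuousLinearMap.rayleighQuotient`, `Module.End.eigenspace`.
Mathlib has no notion of symmetric / positive / essentially self-adjoint `LinearPMap`, no Rayleigh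
quotient and no eigenspaces for `LinearPMap` (searched `IsSymmetric`, `eigenspace`, `rayleigh` in
`LinearAlgebra/LinearPMap.lean`, `Topology/Algebra/Module/LinearPMap.lean`,
`Analysis/InnerProductSpace/LinearPMap.lean`).

## Design choices

* All new declarations are deliberate dot-notation extensions in `namespace LinearPMap`
  (resp. `LinearMap.IsSymmetric`, `LinearMap.IsPositive` for the two bridge lemmas); each
  docstring says so. They are unbundled `Prop`-valued predicates, no classes.
* Generality `[RCLike 𝕜]`; `[CompleteSpace E]` only in the `IsSelfAdjoint` /
  essential-self-adjointness section (Mathlib's `Star` instance on `E →ₗ.[𝕜] E` needs it).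
* Inner products are written `⟪x, A x⟫` (linear in the second slot), matching
  `LinearPMap.IsFormalAdjoint`; for symmetric `A` this equals `⟪A x, x⟫`, so `IsPositive`
  agrees with Mathlib's `LinearMap.IsPositive` on globally defined maps
  (`LinearMap.IsPositive.isPositive_toPMap`).
* `infRayleighOn` is a real `⨅`, hence takes the junk value `0` when the index type is empty
  (`dom A ∩ K = 0`) or the Rayleigh quotient is unbounded below; target statements therefore
  quantify with `IsBoundedBelowOn` and use `infRayleighOn` only under such hypotheses.
* The name `IsSelfAdjoint.isSymmetric` is already taken in Mathlib (for continuous linear maps),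
  so the `LinearPMap` version is called `IsSelfAdjoint.isSymmetric_linearPMap`.
-/

noncomputable section

open RCLike

open scoped ComplexConjugate InnerProductSpace

variable {𝕜 E : Type*} [RCLike 𝕜] [NormedAddCommGroup E] [InnerProductSpace 𝕜 E]

local notation "⟪" x ", " y "⟫" => inner 𝕜 x y

namespace LinearPMap

/-! ### Symmetric and positive partially defined operators -/

section Symmetric

/-- (Dot-notation extension of Mathlib's `LinearPMap`.) A partially defined operator
`A : E →ₗ.[𝕜] E` is *symmetric* if `⟪A x, y⟫ = ⟪x, A y⟫` for all `x, y ∈ dom A`, i.e. `A` is a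
formal adjoint of itself (Reed–Simon, *Methods of Modern Mathematical Physics I*, §VIII.2,
Definition p. 255; note that we do not require `dom A` to be dense). [folklore] -/
abbrev IsSymmetric (A : E →ₗ.[𝕜] E) : Prop :=
  A.IsFormalAdjoint A

/-- Unfolding of `LinearPMap.IsSymmetric` (Reed–Simon I, §VIII.2). [folklore] -/
theorem isSymmetric_iff (A : E →ₗ.[𝕜] E) :
    A.IsSymmetric ↔ ∀ x y : A.domain, ⟪A x, (y : E)⟫ = ⟪(x : E), A y⟫ :=
  Iff.rfl

/-- For a symmetric operator the quadratic form `⟪x, A x⟫` is real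
(Reed–Simon I, §VIII.2; Kato, *Perturbation Theory for Linear Operators*, V §3.10). [folklore] -/
theorem IsSymmetric.im_inner_self_eq_zero {A : E →ₗ.[𝕜] E} (hA : A.IsSymmetric)
    (x : A.domain) : im ⟪(x : E), A x⟫ = 0 := by
  -- `⟪x, A x⟫ = conj ⟪A x, x⟫ = conj ⟪x, A x⟫`, so the form is real.
  have h : conj ⟪(x : E), A x⟫ = ⟪(x : E), A x⟫ := by
    rw [inner_conj_symm, hA x x]
  have := congrArg im h
  rw [conj_im] at this
  linarith

/-- (Dot-notation extension of Mathlib's `LinearPMap`.) A partially defined operator is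
*positive* (non-negative) if it is symmetric and `0 ≤ re ⟪x, A x⟫` for every `x ∈ dom A`
(Reed–Simon II, §X.3, p. 176; Kato V §3.10). Mirrors Mathlib's `LinearMap.IsPositive`. [folklore] -/
def IsPositive (A : E →ₗ.[𝕜] E) : Prop :=
  A.IsSymmetric ∧ ∀ x : A.domain, 0 ≤ re ⟪(x : E), A x⟫

/-- A positive operator is symmetric (by definition). [folklore] -/
theorem IsPositive.isSymmetric {A : E →ₗ.[𝕜] E} (hA : A.IsPositive) : A.IsSymmetric :=
  hA.1

/-- A positive operator has non-negative quadratic form (by definition). [folklore] -/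
theorem IsPositive.re_inner_nonneg {A : E →ₗ.[𝕜] E} (hA : A.IsPositive) (x : A.domain) :
    0 ≤ re ⟪(x : E), A x⟫ :=
  hA.2 x

/-- (Dot-notation extension of Mathlib's `LinearMap.IsSymmetric`.) A symmetric everywhere-defined
linear map restricted to any submodule `p` is a symmetric `LinearPMap`
(Reed–Simon I, §VIII.2). [folklore] -/
theorem _root_.LinearMap.IsSymmetric.isSymmetric_toPMap {T : E →ₗ[𝕜] E} (hT : T.IsSymmetric)
    (p : Submodule 𝕜 E) : (T.toPMap p).IsSymmetric := by
  intro x y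
  simp only [LinearMap.toPMap_apply]
  exact hT x y

/-- (Dot-notation extension of Mathlib's `LinearMap.IsPositive`.) A positive everywhere-defined
linear map restricted to any submodule `p` is a positive `LinearPMap`
(Reed–Simon II, §X.3). [folklore] -/
theorem _root_.LinearMap.IsPositive.isPositive_toPMap {T : E →ₗ[𝕜] E} (hT : T.IsPositive)
    (p : Submodule 𝕜 E) : (T.toPMap p).IsPositive := by
  refine ⟨hT.isSymmetric.isSymmetric_toPMap p, fun x => ?_⟩
  simp only [LinearMap.toPMap_apply]
  exact hT.re_inner_nonneg_right x

end Symmetric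

/-! ### Rayleigh quotient and lower bounds -/

section Rayleigh

/-- (Dot-notation extension of Mathlib's `LinearPMap`.) The *Rayleigh quotient*
`re ⟪x, A x⟫ / ‖x‖²` of a partially defined operator at `x ∈ dom A`
(Reed–Simon IV, §XIII.1; compare Mathlib's `ContinuousLinearMap.rayleighQuotient`).
Junk value `0` at `x = 0` (division by zero). [folklore] -/
def rayleighQuotient (A : E →ₗ.[𝕜] E) (x : A.domain) : ℝ :=
  re ⟪(x : E), A x⟫ / ‖(x : E)‖ ^ 2

/-- The Rayleigh quotient is homogeneous of degree `0`
(compare `ContinuousLinearMap.rayleigh_smul`). [folklore] -/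
theorem rayleighQuotient_smul (A : E →ₗ.[𝕜] E) (x : A.domain) {c : 𝕜} (hc : c ≠ 0) :
    A.rayleighQuotient (c • x) = A.rayleighQuotient x := by
  by_cases hx : (x : E) = 0
  · simp [rayleighQuotient, hx]
  have hc' : (‖c‖ : ℝ) ≠ 0 := norm_ne_zero_iff.mpr hc
  simp only [rayleighQuotient, Submodule.coe_smul, LinearPMap.map_smul, inner_smul_left,
    inner_smul_right, norm_smul, mul_pow, ← mul_assoc]
  rw [RCLike.mul_conj, ← RCLike.ofReal_pow, RCLike.re_ofReal_mul]
  field_simp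

/-- (Dot-notation extension of Mathlib's `LinearPMap`.) `A.IsBoundedBelowOn K c` means
`A ≥ c` in the form sense on `dom A ∩ K`: `c ‖x‖² ≤ re ⟪x, A x⟫` for all `x ∈ dom A` with `x ∈ K`
(Kato, *Perturbation Theory*, V §3.10 "bounded from below"; with `K = ⊤` this is `A ≥ c`, with
`K = (ground states)ᗮ` it is the spectral-gap inequality, Reed–Simon IV §XIII.1). [folklore] -/
def IsBoundedBelowOn (A : E →ₗ.[𝕜] E) (K : Submodule 𝕜 E) (c : ℝ) : Prop :=
  ∀ x : A.domain, (x : E) ∈ K → c * ‖(x : E)‖ ^ 2 ≤ re ⟪(x : E), A x⟫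

/-- A lower bound on `K` is a lower bound on any smaller submodule `K' ≤ K`. [folklore] -/
theorem IsBoundedBelowOn.mono {A : E →ₗ.[𝕜] E} {K K' : Submodule 𝕜 E} {c : ℝ}
    (h : A.IsBoundedBelowOn K c) (hK : K' ≤ K) : A.IsBoundedBelowOn K' c :=
  fun x hx => h x (hK hx)

/-- A lower bound `c` may be weakened to any `c' ≤ c`. [folklore] -/
theorem IsBoundedBelowOn.anti {A : E →ₗ.[𝕜] E} {K : Submodule 𝕜 E} {c c' : ℝ}
    (h : A.IsBoundedBelowOn K c) (hc : c' ≤ c) : A.IsBoundedBelowOn K c' :=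
  fun x hx => (mul_le_mul_of_nonneg_right hc (sq_nonneg _)).trans (h x hx)

/-- Positivity is symmetry plus the lower bound `0` on all of `dom A` (Kato V §3.10). [folklore] -/
theorem isPositive_iff_isBoundedBelowOn_top (A : E →ₗ.[𝕜] E) :
    A.IsPositive ↔ A.IsSymmetric ∧ A.IsBoundedBelowOn ⊤ 0 := by
  simp only [IsPositive, IsBoundedBelowOn, Submodule.mem_top, forall_const, zero_mul]

/-- A form lower bound `c` on `K` bounds the Rayleigh quotient of every non-zero `x ∈ dom A ∩ K`
from below (Reed–Simon IV, §XIII.1). [folklore] -/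
theorem le_rayleighQuotient_of_isBoundedBelowOn {A : E →ₗ.[𝕜] E} {K : Submodule 𝕜 E} {c : ℝ}
    (h : A.IsBoundedBelowOn K c) (x : A.domain) (hx : (x : E) ∈ K) (hx0 : (x : E) ≠ 0) :
    c ≤ A.rayleighQuotient x := by
  rw [rayleighQuotient, le_div_iff₀ (by positivity)]
  exact h x hx

/-- (Dot-notation extension of Mathlib's `LinearPMap`.) The infimum of the Rayleigh quotient of
`A` over the non-zero vectors of `dom A ∩ K`; for self-adjoint `A` bounded below and `K = ⊤` this
is `inf σ(A)` (min–max principle, Reed–Simon IV, Theorem XIII.1).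
**Junk value**: as a real `⨅` it is `0` when `dom A ∩ K = 0` (empty index) or when the Rayleigh
quotient is unbounded below on `K`; statements use it only together with `IsBoundedBelowOn`. [folklore] -/
def infRayleighOn (A : E →ₗ.[𝕜] E) (K : Submodule 𝕜 E) : ℝ :=
  ⨅ x : {x : A.domain // (x : E) ∈ K ∧ (x : E) ≠ 0}, A.rayleighQuotient x.1

/-- A form lower bound `c` on `K` is a lower bound for `infRayleighOn A K`, provided
`dom A ∩ K ≠ 0` (otherwise the infimum is the junk value `0`). [folklore] -/
theorem le_infRayleighOn_of_isBoundedBelowOn {A : E →ₗ.[𝕜] E} {K : Submodule 𝕜 E} {c : ℝ}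
    (h : A.IsBoundedBelowOn K c) (hne : ∃ x : A.domain, (x : E) ∈ K ∧ (x : E) ≠ 0) :
    c ≤ A.infRayleighOn K := by
  obtain ⟨x, hx⟩ := hne
  haveI : Nonempty {x : A.domain // (x : E) ∈ K ∧ (x : E) ≠ 0} := ⟨⟨x, hx⟩⟩
  exact le_ciInf fun y => le_rayleighQuotient_of_isBoundedBelowOn h y.1 y.2.1 y.2.2

end Rayleigh

/-! ### Eigenvalues and eigenvectors of partially defined operators -/

section Eigen

/-- (Dot-notation extension of Mathlib's `LinearPMap`.) The eigenspace of a partially defined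
operator `A` for `μ : 𝕜`: the vectors `x ∈ dom A` with `A x = μ x`, as a submodule of `E`
(the image under `dom A ↪ E` of the kernel of `A - μ`; compare `Module.End.eigenspace`;
Reed–Simon I, §VI.3 / §VIII.1 for the point spectrum of unbounded operators). [folklore] -/
def eigenspace (A : E →ₗ.[𝕜] E) (μ : 𝕜) : Submodule 𝕜 E :=
  (LinearMap.ker (A.toFun - μ • A.domain.subtype)).map A.domain.subtype

/-- Membership in the eigenspace: `x ∈ dom A` and `A x = μ x`. [folklore] -/
theorem mem_eigenspace_iff {A : E →ₗ.[𝕜] E} {μ : 𝕜} {x : E} :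
    x ∈ A.eigenspace μ ↔ ∃ hx : x ∈ A.domain, A ⟨x, hx⟩ = μ • x := by
  constructor
  · rintro ⟨y, hy, rfl⟩
    refine ⟨y.2, ?_⟩
    simpa [sub_eq_zero] using hy
  · rintro ⟨hx, h⟩
    refine ⟨⟨x, hx⟩, ?_, rfl⟩
    simpa [sub_eq_zero] using h

/-- The eigenspace is contained in the domain. [folklore] -/
theorem eigenspace_le_domain (A : E →ₗ.[𝕜] E) (μ : 𝕜) : A.eigenspace μ ≤ A.domain :=
  fun _ hx => (mem_eigenspace_iff.mp hx).1

/-- For an everywhere-defined map `T`, the `LinearPMap` eigenspace of `T.toPMap ⊤` is Mathlib's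
`Module.End.eigenspace T`. [folklore] -/
theorem eigenspace_toPMap_top (T : E →ₗ[𝕜] E) (μ : 𝕜) :
    (T.toPMap ⊤).eigenspace μ = Module.End.eigenspace T μ := by
  ext x
  simp [mem_eigenspace_iff, LinearMap.toPMap_apply]

/-- (Dot-notation extension of Mathlib's `LinearPMap`.) `μ` is an eigenvalue of `A` if its
eigenspace is non-trivial (compare `Module.End.HasEigenvalue`; Reed–Simon I, §VI.3). [folklore] -/
def HasEigenvalue (A : E →ₗ.[𝕜] E) (μ : 𝕜) : Prop :=
  A.eigenspace μ ≠ ⊥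

/-- (Dot-notation extension of Mathlib's `LinearPMap`.) `x` is an eigenvector of `A` for `μ` if
`x ≠ 0`, `x ∈ dom A` and `A x = μ x` (compare `Module.End.HasEigenvector`). [folklore] -/
def HasEigenvector (A : E →ₗ.[𝕜] E) (μ : 𝕜) (x : E) : Prop :=
  x ∈ A.eigenspace μ ∧ x ≠ 0

/-- `μ` is an eigenvalue iff it has an eigenvector (compare
`Module.End.hasEigenvalue_iff`). [folklore] -/
theorem hasEigenvalue_iff {A : E →ₗ.[𝕜] E} {μ : 𝕜} :
    A.HasEigenvalue μ ↔ ∃ x, A.HasEigenvector μ x := by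
  simp only [HasEigenvalue, HasEigenvector, ne_eq, Submodule.eq_bot_iff, not_forall,
    exists_prop]

/-- (Dot-notation extension of Mathlib's `LinearPMap`.) The kernel `{x ∈ dom A | A x = 0}` of a
partially defined operator, as a submodule of `E`; by definition the `0`-eigenspace. [folklore] -/
abbrev kernel (A : E →ₗ.[𝕜] E) : Submodule 𝕜 E :=
  A.eigenspace 0

/-- Membership in the kernel: `x ∈ dom A` and `A x = 0`. [folklore] -/
theorem mem_kernel_iff {A : E →ₗ.[𝕜] E} {x : E} :
    x ∈ A.kernel ↔ ∃ hx : x ∈ A.domain, A ⟨x, hx⟩ = 0 := by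
  simp [mem_eigenspace_iff]

/-- Eigenvalues of a symmetric operator are real (Reed–Simon I, §VIII.2). [cite: ReedSimonI1980, §VIII.2] -/
def IsSymmetric.conj_eq_of_hasEigenvalue : Prop :=
  ∀ {A : E →ₗ.[𝕜] E} (hA : A.IsSymmetric) {μ : 𝕜} (hμ : A.HasEigenvalue μ),
    conj μ = μ

/-- Eigenvectors of a symmetric operator for distinct eigenvalues are orthogonal
(Reed–Simon I, §VIII.2). [cite: ReedSimonI1980, §VIII.2] -/
def IsSymmetric.inner_eq_zero_of_hasEigenvector_of_ne : Prop :=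
  ∀ {A : E →ₗ.[𝕜] E} (hA : A.IsSymmetric) {μ ν : 𝕜} (hμν : μ ≠ ν) {x y : E} (hx : A.HasEigenvector μ x) (hy : A.HasEigenvector ν y),
    ⟪x, y⟫ = 0

end Eigen

/-! ### Self-adjoint and essentially self-adjoint operators -/

section SelfAdjoint

variable [CompleteSpace E]

/-- A self-adjoint partially defined operator (`A† = A`, Mathlib's `IsSelfAdjoint` for
`LinearPMap.instStar`) is symmetric (Reed–Simon I, §VIII.2). The Mathlib name
`IsSelfAdjoint.isSymmetric` is taken by the bounded version, hence the suffix. [folklore] -/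
theorem _root_.IsSelfAdjoint.isSymmetric_linearPMap {A : E →ₗ.[𝕜] E} (hA : IsSelfAdjoint A) :
    A.IsSymmetric := by
  have h : A†.IsFormalAdjoint A := A.adjoint_isFormalAdjoint hA.dense_domain
  rwa [isSelfAdjoint_def.mp hA] at h

/-- (Dot-notation extension of Mathlib's `LinearPMap`.) `A` is *essentially self-adjoint* if it
is closable and its closure is self-adjoint (Reed–Simon I, §VIII.2, Definition p. 256). [folklore] -/
def IsEssentiallySelfAdjoint (A : E →ₗ.[𝕜] E) : Prop :=
  A.IsClosable ∧ IsSelfAdjoint A.closure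

/-- A self-adjoint operator is essentially self-adjoint (it is closed, hence closable with
closure itself; Reed–Simon I, §VIII.2). [folklore] -/
theorem _root_.IsSelfAdjoint.isEssentiallySelfAdjoint {A : E →ₗ.[𝕜] E} (hA : IsSelfAdjoint A) :
    A.IsEssentiallySelfAdjoint := by
  have hc : A.IsClosable := hA.isClosed.isClosable
  have heq : A.closure = A := by
    refine (eq_of_eq_graph ?_).symm
    rw [← hc.graph_closure_eq_closure_graph]
    exact (hA.isClosed.submodule_topologicalClosure_eq).symm
  refine ⟨hc, ?_⟩
  rw [heq]
  exact hA

/-- An essentially self-adjoint operator is symmetric (it is a restriction of its self-adjoint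
closure; Reed–Simon I, §VIII.2). [cite: ReedSimonI1980, §VIII.2] -/
def IsEssentiallySelfAdjoint.isSymmetric : Prop :=
  ∀ {A : E →ₗ.[𝕜] E} (hA : A.IsEssentiallySelfAdjoint),
    A.IsSymmetric

/-- Positivity passes from a core to the operator: if `S` is a core of `A`
(Mathlib's `LinearPMap.HasCore`) and the restriction `A|S` is positive, then so is `A`
(the quadratic form of the closure is the limit along the graph; Reed–Simon II, §X.3;
Kato V §3.10, VI §1.4). [cite: ReedSimonII1975, §X.3] -/
def IsPositive.of_hasCore : Prop :=
  ∀ {A : E →ₗ.[𝕜] E} {S : Submodule 𝕜 E} (hS : A.HasCore S) (h : (A.domRestrict S).IsPositive),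
    A.IsPositive

end SelfAdjoint

end LinearPMap

/-! ### Discharge of `LinearPMap.IsPositive.of_hasCore`

Positivity and symmetry are *closed* conditions on the graph `Γ(A) ⊆ E × E`: the sets
`{(x, x') | 0 ≤ re ⟪x, x'⟫}` and, for fixed `(y, y')`, `{(x, x') | ⟪x', y⟫ = ⟪x, y'⟫}` are closed.
Hence they pass from `Γ(A|S)` to its closure, which contains `Γ(A)` when `S` is a core
(Kato, *Perturbation Theory for Linear Operators*, V §3.10, Problem 3.7: "if `T` is closable then
`Θ(T)` is dense in `Θ(T̃)`", and loc. cit.: "the closure of a symmetric operator is symmetric";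
Reed–Simon II, §X.3). -/

namespace LinearPMap

section OfHasCore

/-- Positivity is a closed condition on the graph: if the graph of `A` lies in the (topological)
closure of the graph of a positive operator `B`, then `A` is positive. This is the graph form of
Kato V §3.10, Problem 3.7 (numerical range of the closure) together with "the closure of a
symmetric operator is symmetric" (loc. cit.). [cite: Kato1966, V §3.10 Problem 3.7] -/
theorem IsPositive.of_graph_subset_closure {A B : E →ₗ.[𝕜] E} (hB : B.IsPositive)
    (h : (A.graph : Set (E × E)) ⊆ _root_.closure (B.graph : Set (E × E))) : A.IsPositive := by
  -- Step 1: `⟪x', y⟫ = ⟪x, B y⟫` for `(x, x') ∈ Γ(A)` and `y ∈ dom B`.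
  have h1 : ∀ p ∈ (A.graph : Set (E × E)), ∀ y : B.domain, ⟪p.2, (y : E)⟫ = ⟪p.1, B y⟫ := by
    intro p hp y
    have hc : _root_.IsClosed {p : E × E | ⟪p.2, (y : E)⟫ = ⟪p.1, B y⟫} :=
      isClosed_eq (continuous_snd.inner continuous_const) (continuous_fst.inner continuous_const)
    refine (hc.closure_subset_iff.mpr ?_) (h hp)
    intro q hq
    obtain ⟨x, hx1, hx2⟩ := (B.mem_graph_iff).mp hq
    show ⟪q.2, (y : E)⟫ = ⟪q.1, B y⟫
    rw [← hx1, ← hx2]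
    exact hB.1 x y
  -- Step 2: `⟪x', y⟫ = ⟪x, y'⟫` for `(x, x'), (y, y') ∈ Γ(A)`.
  have h2 : ∀ p ∈ (A.graph : Set (E × E)), ∀ q ∈ (A.graph : Set (E × E)),
      ⟪p.2, q.1⟫ = ⟪p.1, q.2⟫ := by
    intro p hp q hq
    have hc : _root_.IsClosed {q : E × E | ⟪p.2, q.1⟫ = ⟪p.1, q.2⟫} :=
      isClosed_eq (continuous_const.inner continuous_fst) (continuous_const.inner continuous_snd)
    refine (hc.closure_subset_iff.mpr ?_) (h hq)
    intro q hq
    obtain ⟨y, hy1, hy2⟩ := (B.mem_graph_iff).mp hq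
    show ⟪p.2, q.1⟫ = ⟪p.1, q.2⟫
    rw [← hy1, ← hy2]
    exact h1 p hp y
  -- Step 3: `0 ≤ re ⟪x, x'⟫` for `(x, x') ∈ Γ(A)`.
  have h3 : ∀ p ∈ (A.graph : Set (E × E)), 0 ≤ re ⟪p.1, p.2⟫ := by
    intro p hp
    have hc : _root_.IsClosed {p : E × E | 0 ≤ re ⟪p.1, p.2⟫} :=
      isClosed_le continuous_const (continuous_re.comp (continuous_fst.inner continuous_snd))
    refine (hc.closure_subset_iff.mpr ?_) (h hp)
    intro q hq
    obtain ⟨x, hx1, hx2⟩ := (B.mem_graph_iff).mp hq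
    show 0 ≤ re ⟪q.1, q.2⟫
    rw [← hx1, ← hx2]
    exact hB.2 x
  exact ⟨fun x y => h2 _ (A.mem_graph x) _ (A.mem_graph y), fun x => h3 _ (A.mem_graph x)⟩

/-- If `S` is a core of `A` (Mathlib's `LinearPMap.HasCore`), the graph of `A` lies in the closure
of the graph of `A|S`. (If `A|S` is closable this is
`LinearPMap.IsClosable.graph_closure_eq_closure_graph`; otherwise Mathlib's `closure` is the junk
value `A|S` itself and `HasCore` forces `A|S = A`.) [folklore] -/
theorem HasCore.graph_subset_closure_graph_domRestrict {A : E →ₗ.[𝕜] E} {S : Submodule 𝕜 E}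
    (hS : A.HasCore S) :
    (A.graph : Set (E × E)) ⊆ _root_.closure ((A.domRestrict S).graph : Set (E × E)) := by
  by_cases hc : (A.domRestrict S).IsClosable
  · have := hc.graph_closure_eq_closure_graph
    rw [hS.closure_eq] at this
    rw [← this]
    exact subset_rfl
  · have := hS.closure_eq
    rw [closure_def' hc] at this
    rw [this]
    exact subset_closure

/-- **Discharge** of the named fact `LinearPMap.IsPositive.of_hasCore`: positivity passes from a
core to the operator (Reed–Simon II, §X.3; Kato V §3.10, Problem 3.7 and "the closure of a
symmetric operator is symmetric"). Proof: `Γ(A) ⊆ closure Γ(A|S)`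
(`HasCore.graph_subset_closure_graph_domRestrict`) and positivity is a closed condition on the
graph (`IsPositive.of_graph_subset_closure`).
[cite: ReedSimonII1975, §X.3] [cite: Kato1966, V §3.10 Problem 3.7] -/
theorem IsPositive.of_hasCore_holds : IsPositive.of_hasCore (𝕜 := 𝕜) (E := E) :=
  fun hS h => h.of_graph_subset_closure hS.graph_subset_closure_graph_domRestrict

end OfHasCore

end LinearPMap
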